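/-
Copyright: rh-split cell (dbn column, prover seat l19-w2) gen 2, 2026-08-27.  LINE 3 «two-ray Laguerre
squeeze» of ideator rh-idea-2 (D-0145): by-name instances of the squeeze witness of data.  The linear-factor
ray is an RH-STRENGTHENING conjunct; `¬Ray` statements are RH-free negative-side structure.  Nothing here bears
on the truth of RH.
-/
import Summits.RiemannHypothesis.RiemannHypothesis.Theorems.Splittings.LinearRaySqueezeWitness
import Summits.RiemannHypothesis.RiemannHypothesis.Theses.DBN
import HarnessLib

/-!
# The route items `DBN.TypicalGapSqueezeWitness25` / the `∃`-clause of `DBN.TypicalGapSqueezeSupply` from data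

By-name corollaries of `LinearRaySqueezeWitness.squeezeWitness_of_data` for the two squeeze-witness statements of
route `DBN` (LINE 3 of rh-idea-2):

* `typicalGapSqueezeWitness25_of_data` — orientation `σ = ±1`, brackets `140000 ≤ p₁ < q₁ ≤ p₂ < q₂` with
  `25 (q₂ − p₁) ≤ 1`, the five sign conditions on `Re H_0`, `Re H_0^{(1)}` and the hull margin
  `25 (q₂ − p₁) |Re H_0| < |Re F_25|` on `[p₁, q₂]` give `DBN.TypicalGapSqueezeWitness25`
  (stmt-RiemannHypothesis-22511) BY NAME — this is exactly what instrument «I-72k» §4 (rh-idea-2) has to certify at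
  the Lehman bump `t ≈ 71732.90 / 71732.92` (`x = 2t`), all exact-zero clauses being discharged here;
* `not_hasOnlyRealZeros_linearFactorH_twentyFive_of_data` — the same data (no height condition) give
  `¬ HasOnlyRealZeros (linearFactorH 25)`: the rate-`25` instance of the generic squeeze certificate
  `not_hasOnlyRealZeros_linearFactorH_of_squeezeData`; it agrees with the composite
  data → item 22511 → `¬Ray(25)` through the landed glue
  `LinearRaySwing.not_hasOnlyRealZeros_linearFactorH_twentyFive_of_witness` (`Theorems/Splittings/LinearRaySqueezeGlue.lean`,
  not imported here to keep this file out of the second-level Theses cone);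
* `typicalGapSqueezeSupply_clause_of_data` — for one fixed `a ≥ 0`, the data give the `∃ x₁ x₂ …` clause of
  `DBN.TypicalGapSqueezeSupply` (stmt-RiemannHypothesis-22394) verbatim; the crux itself asks this for EVERY `a > 21`
  (under RH) and is not a finite certificate — nothing here claims it.

Pure logic over the tree; no `sorry`, no new axioms, no instances, no notation, no definitions.  RH is not proved
by any of this; nothing here bears on the truth of RH.
-/

set_option linter.dupNamespace false  -- the mandated namespace repeats `RiemannHypothesis`

namespace Summit.RiemannHypothesis.RiemannHypothesis.Theorems.Splittings.LinearRaySqueezeWitness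

open Set
open Literature.NumberTheory.LFunctions
open Literature.Barriers.RiemannHypothesis (linearFactorH)
open Summit.RiemannHypothesis.RiemannHypothesis.Theorems.Splittings

/-- **Item `DBN.TypicalGapSqueezeWitness25` (stmt-RiemannHypothesis-22511) from data.**  Orientation `σ = ±1`,
brackets `140000 ≤ p₁ < q₁ ≤ p₂ < q₂` with `25 (q₂ − p₁) ≤ 1`; `σ·Re H_0(p₁) < 0`, `σ·Re H_0(q₂) < 0`,
`σ·Re H_0 > 0` on `[q₁, p₂]`, `σ·Re H_0^{(1)} > 0` on `[p₁, q₁]`, `σ·Re H_0^{(1)} < 0` on `[p₂, q₂]`, and the hull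
margin `25 (q₂ − p₁) |Re H_0(y)| < |Re F_25(y)|` on `[p₁, q₂]` (`F_25 = deBruijnHDiv (1 + u²/25²)`).  The
exact zeros, their simplicity and consecutiveness are supplied by `squeezeWitness_of_data`.  An RH-free finite
certificate interface; nothing here bears on the truth of RH. -/
theorem typicalGapSqueezeWitness25_of_data {σ p₁ q₁ p₂ q₂ : ℝ} (hσ : σ = 1 ∨ σ = -1) (hp : 140000 ≤ p₁)
    (h₁ : p₁ < q₁) (h₁₂ : q₁ ≤ p₂) (h₂ : p₂ < q₂) (hreach : 25 * (q₂ - p₁) ≤ 1)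
    (hp₁ : σ * (deBruijnH 0 ((p₁ : ℝ) : ℂ)).re < 0) (hq₂ : σ * (deBruijnH 0 ((q₂ : ℝ) : ℂ)).re < 0)
    (hmid : ∀ y ∈ Icc q₁ p₂, 0 < σ * (deBruijnH 0 ((y : ℝ) : ℂ)).re)
    (hup : ∀ y ∈ Icc p₁ q₁, 0 < σ * (deBruijnH0Deriv 1 ((y : ℝ) : ℂ)).re)
    (hdown : ∀ y ∈ Icc p₂ q₂, σ * (deBruijnH0Deriv 1 ((y : ℝ) : ℂ)).re < 0)
    (hmargin : ∀ y ∈ Icc p₁ q₂, 25 * (q₂ - p₁) * |(deBruijnH 0 ((y : ℝ) : ℂ)).re|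
      < |(deBruijnHDiv (fun u : ℝ => 1 + u ^ 2 / (25 : ℝ) ^ 2) ((y : ℝ) : ℂ)).re|) :
    Summit.RiemannHypothesis.RiemannHypothesis.Theses.DBN.TypicalGapSqueezeWitness25 := by
  unfold Summit.RiemannHypothesis.RiemannHypothesis.Theses.DBN.TypicalGapSqueezeWitness25
  obtain ⟨x₁, x₂, hx₁, -, hx, haδ, hz₁, hz₂, hd₁, hd₂, hgap, hbig⟩ :=
    squeezeWitness_of_data (a := 25) (by norm_num) hσ h₁ h₁₂ h₂ hreach hp₁ hq₂ hmid hup hdown hmargin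
  exact ⟨x₁, x₂, lt_of_le_of_lt hp hx₁, hx, haδ, hz₁, hz₂, hd₁, hd₂, hgap, hbig⟩

/-- **`¬Ray(25)` from data** (no height condition): the rate-`25` instance of the generic squeeze certificate
`not_hasOnlyRealZeros_linearFactorH_of_squeezeData` (swing lemma, stmt-RiemannHypothesis-22393, GIVEN the ray, against
the certified margin).  With `140000 ≤ p₁` the same data also give the route item (`typicalGapSqueezeWitness25_of_data`)
and hence `¬Ray(25)` through the glue `LinearRaySwing.not_hasOnlyRealZeros_linearFactorH_twentyFive_of_witness`.
Negative-side bookkeeping on an RH-STRENGTHENING ray; nothing here bears on the truth of RH. -/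
theorem not_hasOnlyRealZeros_linearFactorH_twentyFive_of_data {σ p₁ q₁ p₂ q₂ : ℝ} (hσ : σ = 1 ∨ σ = -1)
    (h₁ : p₁ < q₁) (h₁₂ : q₁ ≤ p₂) (h₂ : p₂ < q₂) (hreach : 25 * (q₂ - p₁) ≤ 1)
    (hp₁ : σ * (deBruijnH 0 ((p₁ : ℝ) : ℂ)).re < 0) (hq₂ : σ * (deBruijnH 0 ((q₂ : ℝ) : ℂ)).re < 0)
    (hmid : ∀ y ∈ Icc q₁ p₂, 0 < σ * (deBruijnH 0 ((y : ℝ) : ℂ)).re)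
    (hup : ∀ y ∈ Icc p₁ q₁, 0 < σ * (deBruijnH0Deriv 1 ((y : ℝ) : ℂ)).re)
    (hdown : ∀ y ∈ Icc p₂ q₂, σ * (deBruijnH0Deriv 1 ((y : ℝ) : ℂ)).re < 0)
    (hmargin : ∀ y ∈ Icc p₁ q₂, 25 * (q₂ - p₁) * |(deBruijnH 0 ((y : ℝ) : ℂ)).re|
      < |(deBruijnHDiv (fun u : ℝ => 1 + u ^ 2 / (25 : ℝ) ^ 2) ((y : ℝ) : ℂ)).re|) :
    ¬ HasOnlyRealZeros (linearFactorH 25) :=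
  not_hasOnlyRealZeros_linearFactorH_of_squeezeData (a := 25) (by norm_num) hσ h₁ h₁₂ h₂ hreach hp₁ hq₂ hmid hup
    hdown hmargin

/-- **The `∃`-clause of `DBN.TypicalGapSqueezeSupply` (stmt-RiemannHypothesis-22394) at ONE rate `a ≥ 0` from
data**, verbatim in the route file's shape.  The crux quantifies over every `a > 21` (under RH) and is NOT a finite
certificate; this corollary only records that each single instance is instrument-decidable.  Nothing here bears on
the truth of RH. -/
theorem typicalGapSqueezeSupply_clause_of_data {a σ p₁ q₁ p₂ q₂ : ℝ} (ha : 0 ≤ a) (hσ : σ = 1 ∨ σ = -1)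
    (h₁ : p₁ < q₁) (h₁₂ : q₁ ≤ p₂) (h₂ : p₂ < q₂) (hreach : a * (q₂ - p₁) ≤ 1)
    (hp₁ : σ * (deBruijnH 0 ((p₁ : ℝ) : ℂ)).re < 0) (hq₂ : σ * (deBruijnH 0 ((q₂ : ℝ) : ℂ)).re < 0)
    (hmid : ∀ y ∈ Icc q₁ p₂, 0 < σ * (deBruijnH 0 ((y : ℝ) : ℂ)).re)
    (hup : ∀ y ∈ Icc p₁ q₁, 0 < σ * (deBruijnH0Deriv 1 ((y : ℝ) : ℂ)).re)
    (hdown : ∀ y ∈ Icc p₂ q₂, σ * (deBruijnH0Deriv 1 ((y : ℝ) : ℂ)).re < 0)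
    (hmargin : ∀ y ∈ Icc p₁ q₂, a * (q₂ - p₁) * |(deBruijnH 0 ((y : ℝ) : ℂ)).re|
      < |(deBruijnHDiv (fun u : ℝ => 1 + u ^ 2 / a ^ 2) ((y : ℝ) : ℂ)).re|) :
    ∃ x₁ x₂ : ℝ, x₁ < x₂ ∧ a * (x₂ - x₁) ≤ 1 ∧
      Literature.NumberTheory.LFunctions.deBruijnH 0 ((x₁ : ℝ) : ℂ) = 0 ∧
      Literature.NumberTheory.LFunctions.deBruijnH 0 ((x₂ : ℝ) : ℂ) = 0 ∧
      Literature.NumberTheory.LFunctions.deBruijnH0Deriv 1 ((x₁ : ℝ) : ℂ) ≠ 0 ∧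
      Literature.NumberTheory.LFunctions.deBruijnH0Deriv 1 ((x₂ : ℝ) : ℂ) ≠ 0 ∧
      (∀ z ∈ Set.Ioo x₁ x₂, Literature.NumberTheory.LFunctions.deBruijnH 0 ((z : ℝ) : ℂ) ≠ 0) ∧
      ∀ y ∈ Set.Icc x₁ x₂, a * (x₂ - x₁) * |(Literature.NumberTheory.LFunctions.deBruijnH 0 ((y : ℝ) : ℂ)).re|
        < |(Literature.NumberTheory.LFunctions.deBruijnHDiv (fun u : ℝ => 1 + u ^ 2 / a ^ 2) ((y : ℝ) : ℂ)).re| := by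
  obtain ⟨x₁, x₂, -, -, hx, haδ, hz₁, hz₂, hd₁, hd₂, hgap, hbig⟩ :=
    squeezeWitness_of_data ha hσ h₁ h₁₂ h₂ hreach hp₁ hq₂ hmid hup hdown hmargin
  exact ⟨x₁, x₂, hx, haδ, hz₁, hz₂, hd₁, hd₂, hgap, hbig⟩

end Summit.RiemannHypothesis.RiemannHypothesis.Theorems.Splittings.LinearRaySqueezeWitness
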